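import Summits.MatrixMultiplication.MatrixMultiplication.Theorems.FarEdgeDescentSignTwistCore
import HarnessLib

/-!
# The sign-twist dictionary, I: leaf identities

Route `FarEdgeDescent` (cell `decomp-mm`, lens 2 «structural dichotomy (special vs generic)»,
gen 32), Kernel VII part 3a; support for the aside `SubLogRate` (stmt-MatrixMultiplication-25371).

Kernel VI classified the `24` permutation twists `𝔖_φ` of `⟨2,2,2⟩` (`n = 2`, `L = 1`) into the
`4` SPECIAL ones (`φ` a product permutation; `𝔖_φ ≅ ⟨2,2,2⟩`) and `20` GENERIC ones.  An exact
invariant computation (commutant dimensions of the three slice spaces and the stabiliser dimension,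
cell file `gen32/twist_invariants.py`) splits the generic ones into three isomorphism types: the
transpose class `ᵀ` (`4` twists, Kernel II), the class `♭` of `T_rd = (1,0)↔(1,1)` and
`T_cd = (0,1)↔(1,1)` (`8` twists) and the class `♭ᵀ` of the `3`-cycle
`C₃ = (0,1)↦(1,0)↦(1,1)↦(0,1)` (`8` twists).  This file and its sequel
(`FarEdgeDescentSignTwist.lean`) prove the DICTIONARY identifying the two new classes with the
Cohn–Umans weight twists of `FarEdgeDescentSignTwistCore.lean`, over any field of characteristic
`≠ 2`.  Here: the star `𝔖_φ` / `𝔖^w` as two leaves glued along the `X`-slot (`starGlue`), the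
lemma that a leafwise substitution with a shared `X`-matrix is a restriction
(`starGlue_sub_restrictsTo`), the substitution matrices `Q = [[1,1],[-1,1]]`, `Q⁻¹`, `D = diag(1,-1)`,
and the ten LEAF IDENTITIES (brute force over the `2·4·2` entries), e.g.
`leaf_Trd_from_sgn : (XQ)^♭(Q⁻¹y') = T_rd(X)y'` — the matrix identity `T_rd(X)·Q = (XQ)^♭` — and
`leaf_C3_from_sgnT` from `C₃(X) = T_rd(X)ᵀ`.

References: H. Cohn, C. Umans, SODA 2013, §3 [CohnUmans2013]; M. Bläser, M. Christandl, J. Zuiddam,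
Chic. J. TCS 2018, Lemma 3, Def. 5 [BlaserChristandlZuiddam2017]; P. Bürgisser, M. Clausen,
M. A. Shokrollahi, *Algebraic Complexity Theory* (1997), §14.2 [BurgisserClausenShokrollahi1997].
-/

noncomputable section

open scoped BigOperators

set_option linter.dupNamespace false

namespace Summit.MatrixMultiplication.MatrixMultiplication.Theorems.FarEdgeDescentSignTwist

open Literature.Computability.AlgebraicComplexity
open Summit.MatrixMultiplication.MatrixMultiplication.Theorems.FarEdgeDescentTwistedStar
open Summit.MatrixMultiplication.MatrixMultiplication.Theorems.FarEdgeDescentTwistRigidity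

universe u

/-! ## Stars glued from two leaves, and leafwise substitutions -/

section Glue
variable {K : Type u} [Field K] {α β : Type*}

/-- **A star with two leaves**: `tl` on the `inl` leaf, `tr` on the `inr` leaf, sharing the middle
slot; mixed blocks vanish. [folklore] -/
def starGlue (tl tr : α → β → α → K) : α ⊕ α → β → α ⊕ α → K
  | Sum.inl a, b, Sum.inl c => tl a b c
  | Sum.inr a, b, Sum.inr c => tr a b c
  | _, _, _ => 0

/-- **Substitution by three matrices** on a single leaf: `(A ⊗ B ⊗ C)·t`. [folklore] -/
def sub [Fintype α] [Fintype β] (A : α → α → K) (B : β → β → K) (C : α → α → K)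
    (t : α → β → α → K) : α → β → α → K :=
  fun a b c => ∑ a₀, ∑ b₀, ∑ c₀, A a a₀ * B b b₀ * C c c₀ * t a₀ b₀ c₀

/-- Block-diagonal matrix on `α ⊕ α`. [folklore] -/
def blk (Ml Mr : α → α → K) : α ⊕ α → α ⊕ α → K
  | Sum.inl x, Sum.inl x₀ => Ml x x₀
  | Sum.inr x, Sum.inr x₀ => Mr x x₀
  | _, _ => 0

/-- **Leafwise substitution with a shared middle matrix is a restriction of the star.** [folklore] -/
theorem starGlue_sub_restrictsTo [Fintype α] [Fintype β] (tl tr : α → β → α → K)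
    (Al Ar : α → α → K) (B : β → β → K) (Cl Cr : α → α → K) :
    TensorRestrictsTo (starGlue tl tr) (starGlue (sub Al B Cl tl) (sub Ar B Cr tr)) := by
  refine ⟨blk Al Ar, B, blk Cl Cr, fun x b y => ?_⟩
  rcases x with a | a <;> rcases y with c | c <;>
    simp [Fintype.sum_sum_type, blk, starGlue, sub]

end Glue

/-! ## The three representative twists and the substitution matrices -/

section Data
variable (K : Type u) [Field K]

/-- `T_rd = (1,0)↔(1,1)`: `X ↦ [[x₀₀,x₀₁],[x₁₁,x₁₀]]` (reverse the second row). [folklore] -/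
def Trd : Equiv.Perm (Fin 2 × Fin 2) := Equiv.swap (1, 0) (1, 1)

/-- `T_cd = (0,1)↔(1,1)`: `X ↦ [[x₀₀,x₁₁],[x₁₀,x₀₁]]` (reverse the second column). [folklore] -/
def Tcd : Equiv.Perm (Fin 2 × Fin 2) := Equiv.swap (0, 1) (1, 1)

/-- `C₃ = (0,1)↦(1,0)↦(1,1)↦(0,1)`: `X ↦ T_rd(X)ᵀ = [[x₀₀,x₁₁],[x₀₁,x₁₀]]`. [folklore] -/
def C3 : Equiv.Perm (Fin 2 × Fin 2) := Equiv.swap (0, 1) (1, 1) * Equiv.swap (0, 1) (1, 0)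

/-- `Q = [[1,1],[-1,1]]` (entry `Q k j`). [folklore] -/
def Qm (k j : Fin 2) : K := if k = 1 ∧ j = 0 then -1 else 1

/-- `Q⁻¹ = ½[[1,-1],[1,1]]` (entry `Q⁻¹ j j'`). [folklore] -/
def Qi (j j' : Fin 2) : K := if j = 0 ∧ j' = 1 then -(2 : K)⁻¹ else (2 : K)⁻¹

/-- `D = diag(1,-1)` as a sign function. [folklore] -/
def dSign (i : Fin 2) : K := if i = 0 then 1 else -1

/-- The identity matrix on `Fin 2`. [folklore] -/
def one₂ (i j : Fin 2) : K := if i = j then 1 else 0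

/-- `D = diag(1,-1)` as a matrix. [folklore] -/
def dMat (i j : Fin 2) : K := if i = j then dSign K i else 0

/-- `DQ⁻¹` (entry `(i, j) ↦ d_i Q⁻¹_{ij}`). [folklore] -/
def dQi (i j : Fin 2) : K := dSign K i * Qi K i j

/-- `QD` (entry `(i, j) ↦ Q_{ij} d_j`). [folklore] -/
def Qd (i j : Fin 2) : K := Qm K i j * dSign K j

/-- A `2 × 2` matrix `M` as a substitution on a leaf slot `Fin 2 × Fin 1`
(entry `(x, x₀) ↦ M_{x₀.1, x.1}`: new variable `x`, old variable `x₀`). [folklore] -/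
def liftMat (M : Fin 2 → Fin 2 → K) (x x₀ : Fin 2 × Fin 1) : K := M x₀.1 x.1

/-- Column substitution `X ↦ XM` on the `X`-slot: entry `[b₀.1 = b.1]·M_{b.2, b₀.2}`. [folklore] -/
def colSub (M : Fin 2 → Fin 2 → K) (b b₀ : Fin 2 × Fin 2) : K :=
  if b₀.1 = b.1 then M b.2 b₀.2 else 0

/-- Row substitution `X ↦ MᵀX` on the `X`-slot: entry `[b₀.2 = b.2]·M_{b.1, b₀.1}`. [folklore] -/
def rowSub (M : Fin 2 → Fin 2 → K) (b b₀ : Fin 2 × Fin 2) : K :=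
  if b₀.2 = b.2 then M b.1 b₀.1 else 0

/-- The coherent leaf `⟨2,2,1⟩`. [folklore] -/
abbrev mm : (Fin 2 × Fin 1) → (Fin 2 × Fin 2) → (Fin 2 × Fin 1) → K := matMulTensor K 2 2 1

/-- The leaf `⟨2,2,1⟩` read through `X^φ`. [folklore] -/
def mmPerm (φ : Equiv.Perm (Fin 2 × Fin 2)) : (Fin 2 × Fin 1) → (Fin 2 × Fin 2) → (Fin 2 × Fin 1) → K :=
  fun a b c => matMulTensor K 2 2 1 a (φ b) c

/-- The sign-weighted leaf `⟨2,2,2⟩_{-1}`-style: `sgn_b · ⟨2,2,1⟩`. [cite: BlaserChristandlZuiddam2017, Def. 5] -/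
def mmSgn : (Fin 2 × Fin 1) → (Fin 2 × Fin 2) → (Fin 2 × Fin 1) → K :=
  fun a b c => sgnWeight K b * matMulTensor K 2 2 1 a b c

/-- The sign-weighted transposed leaf. [cite: CohnUmans2013, §3] -/
def mmSgnT : (Fin 2 × Fin 1) → (Fin 2 × Fin 2) → (Fin 2 × Fin 1) → K :=
  fun a b c => sgnWeight K b * matMulTensor K 2 2 1 a b.swap c

/-- `𝔖_φ` (at `n = 2`, `L = 1`) is the star glued from `⟨2,2,1⟩` and `⟨2,2,1⟩ ∘ X^φ`. [folklore] -/
theorem permStar_eq_starGlue (φ : Equiv.Perm (Fin 2 × Fin 2)) :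
    permStar K 2 1 φ = starGlue (mm K) (mmPerm K φ) := by
  funext a b c
  rcases a with a | a <;> rcases c with c | c <;> rfl

/-- `𝔖^♭` is the star glued from `⟨2,2,1⟩` and `sgn·⟨2,2,1⟩`. [folklore] -/
theorem signStar_eq_starGlue : signStar K = starGlue (mm K) (mmSgn K) := by
  funext a b c
  rcases a with a | a <;> rcases c with c | c <;> rfl

/-- `𝔖^{♭ᵀ}` is the star glued from `⟨2,2,1⟩` and `sgn·⟨2,2,1⟩ ∘ Xᵀ`. [folklore] -/
theorem signTStar_eq_starGlue : signTStar K = starGlue (mm K) (mmSgnT K) := by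
  funext a b c
  rcases a with a | a <;> rcases c with c | c <;> rfl

end Data

/-! ## Leaf identities (brute force over the `2·4·2` entries; characteristic `≠ 2`) -/

section Leaf
variable {K : Type u} [Field K]

/-- `T_rd`, `T_cd`, `C₃` are not product permutations (they are generic). [folklore] -/
theorem not_isProdPerm_Trd : ¬ IsProdPerm (Trd) := by
  rintro ⟨σ, τ, h⟩
  have h1 := h (0, 0)
  have h2 := h (1, 0)
  simp [Trd, Equiv.swap_apply_of_ne_of_ne, Prod.ext_iff] at h1 h2
  exact absurd (h1.2.trans h2.2.symm) (by decide)

/-- See `not_isProdPerm_Trd`. [folklore] -/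
theorem not_isProdPerm_Tcd : ¬ IsProdPerm (Tcd) := by
  rintro ⟨σ, τ, h⟩
  have h1 := h (0, 0)
  have h2 := h (0, 1)
  simp [Tcd, Equiv.swap_apply_of_ne_of_ne, Prod.ext_iff] at h1 h2
  exact absurd (h1.1.trans h2.1.symm) (by decide)

/-- See `not_isProdPerm_Trd`. [folklore] -/
theorem not_isProdPerm_C3 : ¬ IsProdPerm (C3) := by
  rintro ⟨σ, τ, h⟩
  have h1 := h (0, 0)
  have h2 := h (0, 1)
  simp [C3, Equiv.Perm.mul_apply, Equiv.swap_apply_of_ne_of_ne, Prod.ext_iff] at h1 h2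
  exact absurd (h1.1.trans h2.1.symm) (by decide)

/-- Coherent leaf, `X ↦ XQ`, `y ↦ Q⁻¹y`: `(XQ)(Q⁻¹y) = Xy`. [folklore] -/
theorem leaf_col_Q_Qi (h2 : (2 : K) ≠ 0) :
    sub (liftMat K (one₂ K)) (colSub K (Qm K)) (liftMat K (Qi K)) (mm K) = mm K := by
  funext ⟨i, l⟩ ⟨i₁, i₂⟩ ⟨j, l'⟩
  obtain rfl : l = 0 := Subsingleton.elim _ _
  obtain rfl : l' = 0 := Subsingleton.elim _ _
  fin_cases i <;> fin_cases i₁ <;> fin_cases i₂ <;> fin_cases j <;>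
  · simp [sub, Fintype.sum_prod_type, Fin.sum_univ_two, liftMat, colSub, one₂,
      Qm, Qi, matMulTensor]
    try field_simp
    try ring

/-- Coherent leaf, `X ↦ XQ⁻¹`, `y ↦ Qy`. [folklore] -/
theorem leaf_col_Qi_Q (h2 : (2 : K) ≠ 0) :
    sub (liftMat K (one₂ K)) (colSub K (Qi K)) (liftMat K (Qm K)) (mm K) = mm K := by
  funext ⟨i, l⟩ ⟨i₁, i₂⟩ ⟨j, l'⟩
  obtain rfl : l = 0 := Subsingleton.elim _ _
  obtain rfl : l' = 0 := Subsingleton.elim _ _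
  fin_cases i <;> fin_cases i₁ <;> fin_cases i₂ <;> fin_cases j <;>
  · simp [sub, Fintype.sum_prod_type, Fin.sum_univ_two, liftMat, colSub, one₂,
      Qm, Qi, matMulTensor]
    try field_simp
    try ring

/-- Twisted leaf of `T_rd`: `(XQ)^♭ (Q⁻¹y') = T_rd(X) y'`. [folklore] -/
theorem leaf_Trd_from_sgn (h2 : (2 : K) ≠ 0) :
    sub (liftMat K (one₂ K)) (colSub K (Qm K)) (liftMat K (Qi K)) (mmSgn K) = mmPerm K Trd := by
  funext ⟨i, l⟩ ⟨i₁, i₂⟩ ⟨j, l'⟩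
  obtain rfl : l = 0 := Subsingleton.elim _ _
  obtain rfl : l' = 0 := Subsingleton.elim _ _
  fin_cases i <;> fin_cases i₁ <;> fin_cases i₂ <;> fin_cases j <;>
  · simp [sub, Fintype.sum_prod_type, Fin.sum_univ_two, liftMat, colSub, one₂,
      Qm, Qi, mmSgn, mmPerm, Trd, sgnWeight, matMulTensor, Equiv.swap_apply_def]
    try field_simp
    try ring

/-- Twisted leaf of `T_rd`, inverse direction: `T_rd(XQ⁻¹)(Qy') = X^♭ y'`. [folklore] -/
theorem leaf_sgn_from_Trd (h2 : (2 : K) ≠ 0) :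
    sub (liftMat K (one₂ K)) (colSub K (Qi K)) (liftMat K (Qm K)) (mmPerm K Trd) = mmSgn K := by
  funext ⟨i, l⟩ ⟨i₁, i₂⟩ ⟨j, l'⟩
  obtain rfl : l = 0 := Subsingleton.elim _ _
  obtain rfl : l' = 0 := Subsingleton.elim _ _
  fin_cases i <;> fin_cases i₁ <;> fin_cases i₂ <;> fin_cases j <;>
  · simp [sub, Fintype.sum_prod_type, Fin.sum_univ_two, liftMat, colSub, one₂,
      Qm, Qi, mmSgn, mmPerm, Trd, sgnWeight, matMulTensor, Equiv.swap_apply_def]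
    try field_simp
    try ring

/-- Coherent leaf, `X ↦ QᵀX`, `z ↦ Q⁻¹z`. [folklore] -/
theorem leaf_row_Q_Qi (h2 : (2 : K) ≠ 0) :
    sub (liftMat K (Qi K)) (rowSub K (Qm K)) (liftMat K (one₂ K)) (mm K) = mm K := by
  funext ⟨i, l⟩ ⟨i₁, i₂⟩ ⟨j, l'⟩
  obtain rfl : l = 0 := Subsingleton.elim _ _
  obtain rfl : l' = 0 := Subsingleton.elim _ _
  fin_cases i <;> fin_cases i₁ <;> fin_cases i₂ <;> fin_cases j <;>
  · simp [sub, Fintype.sum_prod_type, Fin.sum_univ_two, liftMat, rowSub, one₂,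
      Qm, Qi, matMulTensor]
    try field_simp
    try ring

/-- Coherent leaf, `X ↦ Q⁻ᵀX`, `z ↦ Qz`. [folklore] -/
theorem leaf_row_Qi_Q (h2 : (2 : K) ≠ 0) :
    sub (liftMat K (Qm K)) (rowSub K (Qi K)) (liftMat K (one₂ K)) (mm K) = mm K := by
  funext ⟨i, l⟩ ⟨i₁, i₂⟩ ⟨j, l'⟩
  obtain rfl : l = 0 := Subsingleton.elim _ _
  obtain rfl : l' = 0 := Subsingleton.elim _ _
  fin_cases i <;> fin_cases i₁ <;> fin_cases i₂ <;> fin_cases j <;>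
  · simp [sub, Fintype.sum_prod_type, Fin.sum_univ_two, liftMat, rowSub, one₂,
      Qm, Qi, matMulTensor]
    try field_simp
    try ring

/-- Twisted leaf of `T_cd`: `D Q⁻ᵀ (QᵀX)^♭ (Dy') = T_cd(X) y'`. [folklore] -/
theorem leaf_Tcd_from_sgn (h2 : (2 : K) ≠ 0) :
    sub (liftMat K (dQi K)) (rowSub K (Qm K)) (liftMat K (dMat K)) (mmSgn K) = mmPerm K Tcd := by
  funext ⟨i, l⟩ ⟨i₁, i₂⟩ ⟨j, l'⟩
  obtain rfl : l = 0 := Subsingleton.elim _ _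
  obtain rfl : l' = 0 := Subsingleton.elim _ _
  fin_cases i <;> fin_cases i₁ <;> fin_cases i₂ <;> fin_cases j <;>
  · simp [sub, Fintype.sum_prod_type, Fin.sum_univ_two, liftMat, rowSub, dQi,
      dMat, dSign, Qm, Qi, mmSgn, mmPerm, Tcd, sgnWeight, matMulTensor, Equiv.swap_apply_def]
    try field_simp
    try ring

/-- Twisted leaf of `T_cd`, inverse direction. [folklore] -/
theorem leaf_sgn_from_Tcd (h2 : (2 : K) ≠ 0) :
    sub (liftMat K (Qd K)) (rowSub K (Qi K)) (liftMat K (dMat K)) (mmPerm K Tcd) = mmSgn K := by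
  funext ⟨i, l⟩ ⟨i₁, i₂⟩ ⟨j, l'⟩
  obtain rfl : l = 0 := Subsingleton.elim _ _
  obtain rfl : l' = 0 := Subsingleton.elim _ _
  fin_cases i <;> fin_cases i₁ <;> fin_cases i₂ <;> fin_cases j <;>
  · simp [sub, Fintype.sum_prod_type, Fin.sum_univ_two, liftMat, rowSub, Qd,
      dMat, dSign, Qm, Qi, mmSgn, mmPerm, Tcd, sgnWeight, matMulTensor, Equiv.swap_apply_def]
    try field_simp
    try ring

/-- Twisted leaf of `C₃`: `Q⁻ᵀ ((XQ)^♭)ᵀ y' = C₃(X) y'` with `C₃(X) = T_rd(X)ᵀ`. [folklore] -/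
theorem leaf_C3_from_sgnT (h2 : (2 : K) ≠ 0) :
    sub (liftMat K (Qi K)) (colSub K (Qm K)) (liftMat K (one₂ K)) (mmSgnT K) = mmPerm K C3 := by
  funext ⟨i, l⟩ ⟨i₁, i₂⟩ ⟨j, l'⟩
  obtain rfl : l = 0 := Subsingleton.elim _ _
  obtain rfl : l' = 0 := Subsingleton.elim _ _
  fin_cases i <;> fin_cases i₁ <;> fin_cases i₂ <;> fin_cases j <;>
  · simp [sub, Fintype.sum_prod_type, Fin.sum_univ_two, liftMat, colSub, one₂,
      Qm, Qi, mmSgnT, mmPerm, C3, sgnWeight, matMulTensor, Equiv.swap_apply_def,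
      Equiv.Perm.mul_apply]
    try field_simp
    try ring

/-- Twisted leaf of `C₃`, inverse direction. [folklore] -/
theorem leaf_sgnT_from_C3 (h2 : (2 : K) ≠ 0) :
    sub (liftMat K (Qm K)) (colSub K (Qi K)) (liftMat K (one₂ K)) (mmPerm K C3) = mmSgnT K := by
  funext ⟨i, l⟩ ⟨i₁, i₂⟩ ⟨j, l'⟩
  obtain rfl : l = 0 := Subsingleton.elim _ _
  obtain rfl : l' = 0 := Subsingleton.elim _ _
  fin_cases i <;> fin_cases i₁ <;> fin_cases i₂ <;> fin_cases j <;>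
  · simp [sub, Fintype.sum_prod_type, Fin.sum_univ_two, liftMat, colSub, one₂,
      Qm, Qi, mmSgnT, mmPerm, C3, sgnWeight, matMulTensor, Equiv.swap_apply_def,
      Equiv.Perm.mul_apply]
    try field_simp
    try ring

end Leaf

end Summit.MatrixMultiplication.MatrixMultiplication.Theorems.FarEdgeDescentSignTwist

end
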